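import Summits.ResolutionOfSingularities.ResolutionOfSingularities.Theorems.HilbertSamuelEliminationSigmaMaxModificationsCorridor3RegularPresentation
import Literature.AlgebraicGeometry.Resolution.CanonicalResolutionProofs
import Literature.AlgebraicGeometry.Resolution.SmoothOfRegularPerfectField
import Literature.AlgebraicGeometry.Resolution.QuasiExcellentSchemes
import Literature.AlgebraicGeometry.Resolution.ResolutionOfSingularities
import Mathlib.RingTheory.RegularLocalRing.Polynomial
import Mathlib.RingTheory.Localization.AtPrime.Basic
import Mathlib.RingTheory.Localization.Ideal
import Mathlib.RingTheory.FiniteType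
import Mathlib.RingTheory.DedekindDomain.Basic
import Mathlib.RingTheory.Ideal.Over
import Mathlib.AlgebraicGeometry.Morphisms.ClosedImmersion
import Mathlib.AlgebraicGeometry.Morphisms.Smooth
import Mathlib.AlgebraicGeometry.Morphisms.FiniteType
import HarnessLib

/-!
# `SigmaMaxModificationsCorridor3` (stmt-19249), line `tame_wild` v3: helper **T-emb** —
# local closed embedding into a smooth affine ambient of the embedding dimension

[OURS · L1 W4.2] replaces the role of the "local coordinates / minimal embedding" step of the
confined tame transfer (`stub_confinedTameNu3_of_thor4`, lead res-L1-w42-lead-1 DECISION-H4F §2;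
plan-1 CHAIN v2.3 §4 row stub-2, typed signature `Helpers.stub_Temb_local_smooth_embedding` in
`L/w42/helpers-v2.lean`); NOT a statement of any manuscript under review.

**T-emb.** Let `Y` be a scheme locally of finite type over a field `k` and `y ∈ Y` a point. Then
on an (affine) open neighbourhood `U` of `y` there is a closed immersion `ι : U ↪ Z` over `k` into
an AFFINE REGULAR `k`-scheme `Z` of finite type whose local ring at `ι y` has dimension
`emb.dim 𝒪_{Y,y} = μ(𝔪_{Y,y})` (`exists_local_regular_embedding_le`, any field, `U` inside any
prescribed open `G ∋ y`); over a PERFECT field `Z → Spec k` is smooth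
(`exists_local_smooth_embedding_le`, `stub_Temb_local_smooth_embedding` = the planner's
signature verbatim).

Proof (all ingredients in the tree / Mathlib).
* Ring level (`exists_finiteType_presentation_regular_at`): for a finitely generated `k`-algebra
  `A`, a prime `𝔭` and the local ring `T = A_𝔭`, present `A = k[x₁,…,xₙ]/I` (`φ : P ↠ A`), put
  `𝔫 = φ⁻¹𝔭`, `S = P_𝔫` (regular local: Mathlib `IsRegularRing (MvPolynomial (Fin n) k)`), and
  localise `φ` to a surjection `σ : S ↠ T`. The minimal regular presentation
  (`TameWild.exists_regular_quotient_presentation'`, p464309: cut `S` by kernel elements outside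
  `𝔪_S²`, Matsumura Thm. 14.2) gives `J ⊆ ker σ` with `S/J` regular local of dimension
  `emb.dim T`. Descend: `K := I ∩ (J ∩ P)` satisfies `K·S = J` (an element of `J` is `z/u` with
  `v·φ(z) = 0` for some `v = φ(w) ∉ 𝔭`, so `wz ∈ K`), hence `B := P/K ↠ A` and
  `B_{𝔭 ∩ B} ≅ S/J` (localisation commutes with quotients).
* Scheme level: take an affine open `V = Spec A ∋ y` inside `G` (`A = Γ(Y, V)` is of finite type
  over `k`), apply the ring-level statement to `T = 𝒪_{Y,y} = A_𝔭`
  (`IsAffineOpen.isLocalization_stalk`), let `f₀ : Spec A ↪ Spec B` be the closed immersion and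
  `x_B = f₀(𝔭)`; `𝒪_{Spec B, x_B} ≅ B_{𝔭 ∩ B}` is regular of dimension `emb.dim 𝒪_{Y,y}`, so
  `x_B ∈ Reg (Spec B)`, which is OPEN (`isOpen_regularLocus_of_locallyOfFiniteType_field`,
  Matsumura Cor. to Thm. 30.5); choose an affine open `W ∋ x_B` inside it, `Z := W`,
  `U := fromSpec (f₀⁻¹ W) ⊆ V`, `ι := f₀|_W`; the structure maps agree by
  `IsAffineOpen.SpecMap_appLE_fromSpec`. Over a perfect field a regular scheme locally of finite
  type is smooth (`smooth_of_isRegular_of_perfectField`, Matsumura §30 Remark 2 after Thm. 30.3).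

## Sources
* H. Matsumura, *Commutative Ring Theory* (1986), Thm. 14.2; §30, Cor. to Thm. 30.5 and Remark 2
  after Thm. 30.3. [Matsumura1987]
-/

set_option linter.dupNamespace false -- mandated namespace of this single-conjunct summit

noncomputable section

open CategoryTheory AlgebraicGeometry TopologicalSpace IsLocalRing
open Literature.AlgebraicGeometry.Resolution
open Summit.ResolutionOfSingularities.ResolutionOfSingularities.Theorems.SigmaMaxModificationsCorridor3.TameWild

namespace Summit.ResolutionOfSingularities.ResolutionOfSingularities.Theorems.SigmaMaxModificationsCorridor3.Helpers

universe u

/-! ## Ring level: a finitely generated algebra is, near a prime, the quotient of a finitely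
generated algebra which is regular of the embedding dimension at that prime -/

/-- **[OURS · L1 W4.2] T-emb, ring level.** Let `A` be a finitely generated algebra over a field
`k`, `𝔭 ⊂ A` a prime and `T = A_𝔭` its local ring. Then `A` is a quotient `ψ : B ↠ A` of a finitely
generated `k`-algebra `B` whose localisation at `ψ⁻¹ 𝔭` is a REGULAR local ring of dimension
`emb.dim T = μ(𝔪_T)`. (Present `A = k[x₁,…,xₙ]/I`, localise at `𝔫 = 𝔭 ∩ k[x]`, cut the regular
local ring `k[x]_𝔫` down to the embedding dimension of `T` by kernel elements outside `𝔫²`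
(`TameWild.exists_regular_quotient_presentation'`), and descend the cut `J` to the ideal
`K = I ∩ J ∩ k[x]` of `k[x]`, which satisfies `K · k[x]_𝔫 = J`; `B := k[x]/K`.)
[cite: Matsumura1987, Thm. 14.2] -/
theorem exists_finiteType_presentation_regular_at
    {k : Type u} [Field k] {A : Type u} [CommRing A] [Algebra k A] [Algebra.FiniteType k A]
    (p : Ideal A) [p.IsPrime] (T : Type u) [CommRing T] [Algebra A T] [IsLocalization.AtPrime T p]
    [IsLocalRing T] :
    ∃ (B : Type u) (_ : CommRing B) (_ : Algebra k B) (ψ : B →ₐ[k] A),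
      Algebra.FiniteType k B ∧ Function.Surjective ψ ∧
      IsRegularLocalRing (Localization.AtPrime (Ideal.comap ψ.toRingHom p)) ∧
      ringKrullDim (Localization.AtPrime (Ideal.comap ψ.toRingHom p)) =
        ((maximalIdeal T).spanFinrank : WithBot ℕ∞) := by
  classical
  haveI : IsNoetherianRing A := Algebra.FiniteType.isNoetherianRing k A
  haveI : IsNoetherianRing T := IsLocalization.isNoetherianRing p.primeCompl T inferInstance
  obtain ⟨n, φ, hφ⟩ := Algebra.FiniteType.iff_quotient_mvPolynomial''.mp ‹Algebra.FiniteType k A›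
  -- the polynomial ring, the prime `𝔫 = φ⁻¹ p` and the regular local ring `S = P_𝔫`
  let P := MvPolynomial (Fin n) k
  let 𝔫 : Ideal P := Ideal.comap φ.toRingHom p
  let S := Localization.AtPrime 𝔫
  haveI : IsRegularLocalRing S := inferInstance
  -- the induced surjection `σ : S → T`
  have hMN : 𝔫.primeCompl ≤ p.primeCompl.comap φ.toRingHom := fun x hx => hx
  let σ : S →+* T := IsLocalization.map T φ.toRingHom hMN
  have hσ : Function.Surjective σ := by
    intro t
    obtain ⟨a, s, rfl⟩ := IsLocalization.exists_mk'_eq p.primeCompl t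
    obtain ⟨a', ha'⟩ := hφ a
    obtain ⟨s', hs'⟩ := hφ s.1
    have hs'𝔫 : s' ∈ 𝔫.primeCompl := by
      change s' ∉ Ideal.comap φ.toRingHom p
      rw [Ideal.mem_comap]
      change φ s' ∉ p
      rw [hs']
      exact s.2
    refine ⟨IsLocalization.mk' S a' ⟨s', hs'𝔫⟩, ?_⟩
    rw [IsLocalization.map_mk', IsLocalization.mk'_eq_iff_eq]
    change algebraMap A T (↑s * φ a') = algebraMap A T (φ s' * a)
    rw [ha', hs', mul_comm]
  -- minimal regular presentation of `T` as a quotient of `S`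
  obtain ⟨J, hJker, hJreg, hJdim⟩ := exists_regular_quotient_presentation' σ hσ
  -- descend `J` to an ideal `K ⊆ ker φ` of `P` with `K·S = J`
  let K : Ideal P := RingHom.ker φ.toRingHom ⊓ J.comap (algebraMap P S)
  have hKJ : K.map (algebraMap P S) = J := by
    apply le_antisymm
    · exact Ideal.map_le_of_le_comap inf_le_right
    · intro x hx
      obtain ⟨z, u, rfl⟩ := IsLocalization.exists_mk'_eq 𝔫.primeCompl x
      have h0 : σ (IsLocalization.mk' S z u) = 0 := hJker hx
      rw [IsLocalization.map_mk', IsLocalization.mk'_eq_zero_iff] at h0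
      obtain ⟨v, hv⟩ := h0
      obtain ⟨w, hw⟩ := hφ v.1
      have hw𝔫 : w ∈ 𝔫.primeCompl := by
        change w ∉ Ideal.comap φ.toRingHom p
        rw [Ideal.mem_comap]
        change φ w ∉ p
        rw [hw]
        exact v.2
      have hwz : w * z ∈ K := by
        refine ⟨?_, ?_⟩
        · change w * z ∈ RingHom.ker φ.toRingHom
          rw [RingHom.mem_ker]
          change φ (w * z) = 0
          rw [map_mul, hw]
          exact hv
        · change w * z ∈ J.comap (algebraMap P S)
          rw [Ideal.mem_comap, map_mul, ← IsLocalization.mk'_spec S z u, ← mul_assoc]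
          exact J.mul_mem_right _ (J.mul_mem_left _ hx)
      have hu : IsUnit (algebraMap P S u) := IsLocalization.map_units S u
      have hwS : IsUnit (algebraMap P S w) := IsLocalization.map_units S ⟨w, hw𝔫⟩
      rw [← Ideal.mul_unit_mem_iff_mem _ hu, IsLocalization.mk'_spec,
        ← Ideal.unit_mul_mem_iff_mem _ hwS, ← map_mul]
      exact Ideal.mem_map_of_mem _ hwz
  have hKle : K ≤ RingHom.ker φ.toRingHom := inf_le_left
  -- the algebra `B = P ⧸ K` and the surjection `ψ : B → A`
  let ψ : (P ⧸ K) →ₐ[k] A := Ideal.Quotient.liftₐ K φ (fun a ha => hKle ha)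
  have hψmk : ∀ x : P, ψ (Ideal.Quotient.mk K x) = φ x := fun x => Ideal.Quotient.lift_mk K _ _
  have hψ : Function.Surjective ψ := by
    intro a
    obtain ⟨x, rfl⟩ := hφ a
    exact ⟨Ideal.Quotient.mk K x, hψmk x⟩
  -- the prime `q = ψ⁻¹ p` of `B` and its complement
  have hq : (Ideal.comap ψ.toRingHom p).primeCompl =
      Algebra.algebraMapSubmonoid (P ⧸ K) 𝔫.primeCompl := by
    ext x
    obtain ⟨x, rfl⟩ := Ideal.Quotient.mk_surjective x
    constructor
    · intro hx
      refine ⟨x, ?_, rfl⟩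
      change x ∉ Ideal.comap φ.toRingHom p
      intro hx'
      apply hx
      change Ideal.Quotient.mk K x ∈ Ideal.comap ψ.toRingHom p
      rw [Ideal.mem_comap]
      change ψ (Ideal.Quotient.mk K x) ∈ p
      rw [hψmk]
      exact hx'
    · rintro ⟨x', hx', hxx'⟩
      change Ideal.Quotient.mk K x' = Ideal.Quotient.mk K x at hxx'
      rw [← hxx']
      change Ideal.Quotient.mk K x' ∉ Ideal.comap ψ.toRingHom p
      rw [Ideal.mem_comap]
      change ψ (Ideal.Quotient.mk K x') ∉ p
      rw [hψmk]
      exact hx'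
  -- `B_q ≅ S ⧸ K·S = S ⧸ J`
  haveI : IsLocalization (Ideal.comap ψ.toRingHom p).primeCompl (S ⧸ K.map (algebraMap P S)) := by
    rw [hq]; infer_instance
  let e : Localization.AtPrime (Ideal.comap ψ.toRingHom p) ≃+* S ⧸ J :=
    (IsLocalization.algEquiv (Ideal.comap ψ.toRingHom p).primeCompl
      (Localization.AtPrime (Ideal.comap ψ.toRingHom p)) (S ⧸ K.map (algebraMap P S))).toRingEquiv.trans
      (Ideal.quotEquivOfEq hKJ)
  refine ⟨P ⧸ K, inferInstance, inferInstance, ψ, inferInstance, hψ,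
    IsRegularLocalRing.of_ringEquiv e.symm, ?_⟩
  rw [ringKrullDim_eq_of_ringEquiv e]
  exact hJdim

/-! ## Scheme level -/

/-- **[OURS · L1 W4.2] T-emb over any field: local closed embedding into an affine REGULAR
ambient of the embedding dimension.** Let `Y` be locally of finite type over a field `k`, `y ∈ Y`,
and `G ∋ y` an open. There are an affine open `U` with `y ∈ U ⊆ G`, an affine regular `k`-scheme
`Z` locally of finite type, and a closed immersion `ι : U ↪ Z` over `k` with
`dim 𝒪_{Z, ι y} = emb.dim 𝒪_{Y,y} = μ(𝔪_{Y,y})`. (Ring-level cut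
`exists_finiteType_presentation_regular_at` on an affine chart `V = Spec A ∋ y`, `A = Γ(Y, V)`,
`𝒪_{Y,y} = A_𝔭`; the closed immersion `Spec A ↪ Spec B`; openness of the regular locus of
`Spec B` (`isOpen_regularLocus_of_locallyOfFiniteType_field`); restrict to an affine open of it.)
[cite: Matsumura1987, Thm. 14.2; §30, Cor. to Thm. 30.5] -/
theorem exists_local_regular_embedding_le (k : Type u) [Field k] (Y : Scheme.{u})
    (g : Y ⟶ Spec (.of k)) [LocallyOfFiniteType g] (y : Y) (G : Y.Opens) (hyG : y ∈ G) :
    ∃ (U : Y.Opens) (hyU : y ∈ U) (Z : Scheme.{u}) (h : Z ⟶ Spec (.of k))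
      (ι : (U : Scheme.{u}) ⟶ Z),
      U ≤ G ∧ IsAffineOpen U ∧ IsClosedImmersion ι ∧ ι ≫ h = U.ι ≫ g ∧ Scheme.IsRegular Z ∧
      LocallyOfFiniteType h ∧ IsAffine Z ∧
      ringKrullDim (Z.presheaf.stalk (ι.base ⟨y, hyU⟩)) =
        ((IsLocalRing.maximalIdeal (Y.presheaf.stalk y)).spanFinrank : WithBot ℕ∞) := by
  classical
  -- an affine open `V ∋ y` inside `G`; its coordinate ring is a finitely generated `k`-algebra
  obtain ⟨V, hV, hyV, hVG⟩ := exists_isAffineOpen_mem_and_subset (X := Y) (x := y) (U := G) hyG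
  have hft : RingHom.FiniteType (g.appLE ⊤ V le_top).hom :=
    HasRingHomProperty.appLE @LocallyOfFiniteType g ‹_› ⟨⊤, isAffineOpen_top _⟩ ⟨V, hV⟩ le_top
  let φV : k →+* Γ(Y, V) := (g.appLE ⊤ V le_top).hom.comp (Scheme.ΓSpecIso (.of k)).inv.hom
  have hφV : φV.FiniteType :=
    hft.comp (RingHom.FiniteType.of_surjective _
      (Scheme.ΓSpecIso (.of k)).commRingCatIsoToRingEquiv.symm.surjective)
  letI algkV : Algebra k Γ(Y, V) := φV.toAlgebra
  haveI : Algebra.FiniteType k Γ(Y, V) := hφV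
  -- the point `y` as a prime `𝔭` of `Γ(Y, V)`; the stalk is the localisation at `𝔭`
  let 𝔭 : PrimeSpectrum Γ(Y, V) := hV.primeIdealOf ⟨y, hyV⟩
  letI algVy : Algebra Γ(Y, V) (Y.presheaf.stalk y) :=
    TopCat.Presheaf.algebra_section_stalk Y.presheaf (⟨y, hyV⟩ : V)
  haveI : IsLocalization.AtPrime (Y.presheaf.stalk y) 𝔭.asIdeal := hV.isLocalization_stalk ⟨y, hyV⟩
  -- ring-level core
  obtain ⟨B, _, _, ψ, hBft, hψ, hreg, hdim⟩ :=
    exists_finiteType_presentation_regular_at (k := k) 𝔭.asIdeal (Y.presheaf.stalk y)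
  -- the ambient affine scheme `Spec B` over `k` and the closed immersion `Spec Γ(Y, V) ↪ Spec B`
  let XB : Scheme.{u} := Spec (.of B)
  let πk : XB ⟶ Spec (.of k) := Spec.map (CommRingCat.ofHom (algebraMap k B))
  haveI : LocallyOfFiniteType πk := by
    rw [HasRingHomProperty.Spec_iff (P := @LocallyOfFiniteType)]
    exact RingHom.finiteType_algebraMap.mpr hBft
  let f₀ : Spec Γ(Y, V) ⟶ XB := Spec.map (CommRingCat.ofHom ψ.toRingHom)
  haveI : IsClosedImmersion f₀ := IsClosedImmersion.spec_of_surjective _ hψ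
  -- the image point `xB` of `y` and its local ring
  let xB : XB := f₀ 𝔭
  have hxB : xB.asIdeal = Ideal.comap ψ.toRingHom 𝔭.asIdeal := rfl
  letI algB : Algebra B (XB.presheaf.stalk xB) := StructureSheaf.stalkAlgebra (↑(CommRingCat.of B)) xB
  haveI : IsLocalization.AtPrime (XB.presheaf.stalk xB) xB.asIdeal :=
    StructureSheaf.IsLocalization.to_stalk (↑(CommRingCat.of B)) xB
  haveI : IsLocalization.AtPrime (XB.presheaf.stalk xB) (Ideal.comap ψ.toRingHom 𝔭.asIdeal) :=
    StructureSheaf.IsLocalization.to_stalk (↑(CommRingCat.of B)) xB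
  let eB : XB.presheaf.stalk xB ≃+* Localization.AtPrime (Ideal.comap ψ.toRingHom 𝔭.asIdeal) :=
    (IsLocalization.algEquiv (Ideal.comap ψ.toRingHom 𝔭.asIdeal).primeCompl
      (XB.presheaf.stalk xB) (Localization.AtPrime (Ideal.comap ψ.toRingHom 𝔭.asIdeal))).toRingEquiv
  have hxBreg : xB ∈ Scheme.regularLocus XB := by
    rw [Scheme.mem_regularLocus]
    exact IsRegularLocalRing.of_ringEquiv eB.symm
  -- an affine open `W ∋ xB` inside the (open) regular locus of `Spec B`
  have hopen : IsOpen (Scheme.regularLocus XB) := isOpen_regularLocus_of_locallyOfFiniteType_field πk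
  obtain ⟨W, hW, hxW, hWreg⟩ := exists_isAffineOpen_mem_and_subset (X := XB) (x := xB)
    (U := ⟨Scheme.regularLocus XB, hopen⟩) hxBreg
  have hZreg : Scheme.IsRegular (W : Scheme.{u}) := by
    intro w
    have hw : (w.1 : XB) ∈ Scheme.regularLocus XB := hWreg w.2
    rw [Scheme.mem_regularLocus] at hw
    exact IsRegularLocalRing.of_ringEquiv (W.stalkIso w).commRingCatIsoToRingEquiv.symm
  -- the open `U ∋ y` of `Y` and the closed immersion `ι : U ↪ W`
  let U₀ : (Spec Γ(Y, V)).Opens := f₀ ⁻¹ᵁ W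
  have h𝔭U₀ : (𝔭 : Spec Γ(Y, V)) ∈ U₀ := hxW
  let U : Y.Opens := hV.fromSpec ''ᵁ U₀
  have hyU : y ∈ U := by
    have h1 : hV.fromSpec 𝔭 ∈ hV.fromSpec ''ᵁ U₀ :=
      (hV.fromSpec.apply_mem_image_iff (U := U₀)).mpr h𝔭U₀
    have h2 : hV.fromSpec 𝔭 = y := hV.fromSpec_primeIdealOf ⟨y, hyV⟩
    rw [h2] at h1
    exact h1
  let ι : (U : Scheme.{u}) ⟶ W := (hV.fromSpec.isoImage U₀).inv ≫ (f₀ ∣_ W)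
  have hUV : U ≤ V := by
    intro x hx
    obtain ⟨x', -, rfl⟩ := hx
    exact hV.range_fromSpec.le ⟨x', rfl⟩
  -- compatibility with the structure morphisms
  have hφV' : CommRingCat.ofHom φV = (Scheme.ΓSpecIso (.of k)).inv ≫ g.appLE ⊤ V le_top := rfl
  have hfromSpec : Spec.map (CommRingCat.ofHom φV) = hV.fromSpec ≫ g := by
    rw [hφV', Spec.map_comp, ← Scheme.isoSpec_Spec_inv, ← IsAffineOpen.fromSpec_top]
    exact IsAffineOpen.SpecMap_appLE_fromSpec g (isAffineOpen_top _) hV le_top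
  have hψφ : ψ.toRingHom.comp (algebraMap k B) = φV := ψ.comp_algebraMap
  have hf₀πk : f₀ ≫ πk = hV.fromSpec ≫ g := by
    rw [← hfromSpec, ← hψφ]
    change Spec.map _ ≫ Spec.map _ = _
    rw [← Spec.map_comp]
    rfl
  have hcomp : ι ≫ (W.ι ≫ πk) = U.ι ≫ g := by
    change ((hV.fromSpec.isoImage U₀).inv ≫ (f₀ ∣_ W)) ≫ W.ι ≫ πk = _
    simp only [Category.assoc, morphismRestrict_ι_assoc]
    rw [hf₀πk, Scheme.Hom.isoImage_inv_ι_assoc]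
  -- the image of `y` under `ι` is `xB`
  have hιy : (ι ⟨y, hyU⟩).1 = xB := by
    have h1 : (ι ⟨y, hyU⟩).1 = f₀ (((hV.fromSpec.isoImage U₀).inv ≫ U₀.ι) ⟨y, hyU⟩) := by
      have heq : ι ≫ W.ι = ((hV.fromSpec.isoImage U₀).inv ≫ U₀.ι) ≫ f₀ := by
        change ((hV.fromSpec.isoImage U₀).inv ≫ (f₀ ∣_ W)) ≫ W.ι = _
        rw [Category.assoc, morphismRestrict_ι, Category.assoc]
      change (ι ≫ W.ι) ⟨y, hyU⟩ = (((hV.fromSpec.isoImage U₀).inv ≫ U₀.ι) ≫ f₀) ⟨y, hyU⟩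
      rw [heq]
    have h2 : ((hV.fromSpec.isoImage U₀).inv ≫ U₀.ι) ⟨y, hyU⟩ = 𝔭 := by
      apply hV.fromSpec.isOpenEmbedding.injective
      change (((hV.fromSpec.isoImage U₀).inv ≫ U₀.ι) ≫ hV.fromSpec) ⟨y, hyU⟩ = _
      rw [Category.assoc, Scheme.Hom.isoImage_inv_ι, hV.fromSpec_primeIdealOf ⟨y, hyV⟩]
      rfl
    rw [h1, h2]
  -- the local ring of `W` at `ι y`
  have hdimZ : ringKrullDim ((W : Scheme.{u}).presheaf.stalk (ι.base ⟨y, hyU⟩)) =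
      ((IsLocalRing.maximalIdeal (Y.presheaf.stalk y)).spanFinrank : WithBot ℕ∞) := by
    rw [← hdim, ← ringKrullDim_eq_of_ringEquiv eB,
      ringKrullDim_eq_of_ringEquiv (W.stalkIso (ι.base ⟨y, hyU⟩)).commRingCatIsoToRingEquiv,
      ringKrullDim_eq_of_ringEquiv
        (XB.presheaf.stalkCongr (Inseparable.of_eq hιy)).commRingCatIsoToRingEquiv]
  -- `U` is affine: the preimage of the affine `W` under the affine morphism `f₀`, moved by `fromSpec`
  have hUaff : IsAffineOpen U := (hW.preimage f₀).image_of_isOpenImmersion hV.fromSpec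
  exact ⟨U, hyU, W, W.ι ≫ πk, ι, hUV.trans hVG, hUaff, inferInstance, hcomp, hZreg, inferInstance,
    hW, hdimZ⟩

/-- **[OURS · L1 W4.2] T-emb over a perfect field, with a prescribed neighbourhood: local closed
embedding into a SMOOTH affine ambient of the embedding dimension.** As
`exists_local_regular_embedding_le`, and `Z → Spec k` is smooth because a regular scheme locally of
finite type over a perfect field is smooth (`smooth_of_isRegular_of_perfectField`).
[cite: Matsumura1987, Thm. 14.2; §30 Remark 2 after Thm. 30.3] -/
theorem exists_local_smooth_embedding_le (k : Type u) [Field k] [PerfectField k] (Y : Scheme.{u})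
    (g : Y ⟶ Spec (.of k)) [LocallyOfFiniteType g] (y : Y) (G : Y.Opens) (hyG : y ∈ G) :
    ∃ (U : Y.Opens) (hyU : y ∈ U) (Z : Scheme.{u}) (h : Z ⟶ Spec (.of k))
      (ι : (U : Scheme.{u}) ⟶ Z),
      U ≤ G ∧ IsAffineOpen U ∧ IsClosedImmersion ι ∧ ι ≫ h = U.ι ≫ g ∧ Scheme.IsRegular Z ∧
      Smooth h ∧ LocallyOfFiniteType h ∧ IsAffine Z ∧
      ringKrullDim (Z.presheaf.stalk (ι.base ⟨y, hyU⟩)) =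
        ((IsLocalRing.maximalIdeal (Y.presheaf.stalk y)).spanFinrank : WithBot ℕ∞) := by
  obtain ⟨U, hyU, Z, h, ι, hUG, hUaff, hι, hcomp, hZreg, hft, hZaff, hdim⟩ :=
    exists_local_regular_embedding_le k Y g y G hyG
  haveI := hft
  exact ⟨U, hyU, Z, h, ι, hUG, hUaff, hι, hcomp, hZreg, smooth_of_isRegular_of_perfectField h hZreg,
    hft, hZaff, hdim⟩

/-- **[OURS · L1 W4.2] T-emb (plan-1's typed helper, CHAIN v2.3 §4 / `L/w42/helpers-v2.lean`,
signature verbatim): local closed embedding into a SMOOTH ambient of the embedding dimension.**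
Over a perfect field `k`, a (closed) point `y` of a scheme `Y` locally of finite type embeds, on an
open neighbourhood `U`, as a closed subscheme of a smooth affine `k`-scheme `Z` locally of finite
type whose local ring at `y` has dimension `emb.dim 𝒪_{Y,y} = μ(𝔪_y)`. (The closedness of `y` is
not needed: `exists_local_smooth_embedding_le`.) This is the `HasLocalCoordinates` /
maximal-contact precondition of H2 (`MarkedIdeal.exists_maximalContact_of_smooth`) and of the
confined tame transfer `stub_confinedTameNu3_of_thor4` (lead-1, tame_wild v3).
[cite: Matsumura1987, Thm. 14.2; §30 Remark 2 after Thm. 30.3] -/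
theorem stub_Temb_local_smooth_embedding (k : Type) [Field k] [PerfectField k] (Y : Scheme.{0})
    (g : Y ⟶ Spec (.of k)) [LocallyOfFiniteType g] (y : Y) (hy : IsClosed ({y} : Set Y)) :
    ∃ (U : Y.Opens) (hyU : y ∈ U) (Z : Scheme.{0}) (h : Z ⟶ Spec (.of k))
      (ι : (U : Scheme.{0}) ⟶ Z),
      IsClosedImmersion ι ∧ ι ≫ h = U.ι ≫ g ∧ Smooth h ∧ LocallyOfFiniteType h ∧ IsAffine Z ∧
      ringKrullDim (Z.presheaf.stalk (ι.base ⟨y, hyU⟩)) =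
        ((IsLocalRing.maximalIdeal (Y.presheaf.stalk y)).spanFinrank : WithBot ℕ∞) := by
  have _ := hy
  obtain ⟨U, hyU, Z, h, ι, -, -, hι, hcomp, -, hsm, hft, hZaff, hdim⟩ :=
    exists_local_smooth_embedding_le k Y g y ⊤ trivial
  exact ⟨U, hyU, Z, h, ι, hι, hcomp, hsm, hft, hZaff, hdim⟩

end Summit.ResolutionOfSingularities.ResolutionOfSingularities.Theorems.SigmaMaxModificationsCorridor3.Helpers

end
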